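import Summits.BirchSwinnertonDyer.BirchSwinnertonDyer.Theorems.QuadraticBranchSignedControlPlusEtaNonsurjThetaFunctionalEquationNormCoordinateLeading
import HarnessLib

/-!
# Route `QuadraticBranchSignedControl` (rung K8, cell `bsd-potss`), residual crux `PlusEtaMainConjectureNonsurj`
# (stmt-BirchSwinnertonDyer-19606): THE FUNCTIONAL EQUATION ON THE QUADRATIC BRANCH, XXXI — THE SECOND DIGIT: with `k = (λ − r₀)/2` partner
# pairs, a `ℤ_p`-rational zero of a nonzero solution of `ι M = w(1+T)^e M` forces **`p³ ∣ h₀ = coeff_{r₀}(P)` when `k ≥ 2`** and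
# **`−h₀ ∈ (ℤ_p)²` when `k = 1`** (and conversely for `k = 1`) — the complete decision procedure behind the census P-30M
# (seat `bsd-potss-k8eta-c2` g30; kernel, class-wide, fact-free)

WHY. Part XXX: a zero `t ∈ pℤ_p ∖ 0` of `M` forces `p² ∣ h₀`, `h₀ = H(0) = coeff_{r₀}(P)` the lowest nonzero coefficient of the Weierstrass
polynomial `P = T^{r₀}(1+T)^k H(Z)` (Part XXVI). THIS FILE reads the SECOND digit. The norm `z₀ = t + t^ι ∈ p²ℤ_p` is a root of the distinguished
`H ∈ ℤ_p[Z]`; dividing, `H = (Z − z₀)·H₁` with `H₁` again DISTINGUISHED (mod `𝔪`: `Z·H̄₁ = Z^k`), so if `k ≥ 2` then `p ∣ H₁(0)` and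
**`p³ ∣ h₀ = −z₀·H₁(0)`**; if `k = 1` then `H = Z + h₀`, `z₀ = −h₀`, and `z₀ = S(t)²` (Part XXVIII) gives **`−h₀ ∈ (ℤ_p)²`**; conversely for `k = 1`
a square root `s₀ ≠ 0` of `−h₀` gives the rational zero pair `{S⁻¹(s₀), S⁻¹(s₀)^ι}` (Part XXIX). So the digit test of the census P-30M
(k8eta-c2 g30, level-6 Mazur–Tate elements, `h₀ mod 125`): `v_5(h₀) = 1 ⟹` none; `k ≥ 2 ∧ v_5(h₀) = 2 ⟹` none; `k = 1 ∧ v_5(h₀) = 2 ⟹` a rational pair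
iff `−h₀/25` is a quadratic residue mod `5`; `v_5(h₀) ≥ 3 ⟹` undecided — every branch is a theorem of Parts XXVIII–XXXI.

MATHEMATICS. (§94) `H` distinguished, `H(z₀) = 0`, `z₀ ∈ 𝔪` ⟹ `H = (X − z₀)·(H /ₘ (X − z₀))`, the quotient monic of degree `d − 1` and
`≡ X^{d−1} (mod 𝔪)` (cancel `X` in `k[X]`), i.e. distinguished. (§95) `d ≥ 2` ⟹ `p ∣ H₁(0)`; `p² ∣ z₀` ⟹ `p³ ∣ H(0) = −z₀H₁(0)`. (§96) with Parts
XXVI/XXVIII/XXX: `k ≥ 2` (`deg P ≥ r₀ + 4`) and a zero `t ≠ 0` ⟹ `p³ ∣ coeff_{r₀}(P)` and `p³ ∣ coeff_{r₀}(M)`; `k = 1` (`deg P = r₀ + 2`) and a zero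
⟹ `IsSquare(−coeff_{r₀} P)`; `k = 1` and `−coeff_{r₀} P = s₀²`, `s₀ ∈ pℤ_p ∖ 0` ⟹ a zero pair. (§97) rows.

WHAT. §94 `mem_maximalIdeal_of_root_of_isDistinguishedAt`, **`divByMonic_isDistinguishedAt_of_root`**; §95 `natCast_dvd_coeff_zero_of_isDistinguishedAt`,
**`natCast_pow_three_dvd_coeff_zero_of_root`**; §96 **`natCast_pow_three_dvd_weierstrass_coeff_order_of_zero`**, `natCast_pow_three_dvd_coeff_order_of_zero`,
`evalHom_ne_zero_of_not_pow_three_dvd`, **`isSquare_neg_weierstrass_coeff_order_of_zero`**, **`exists_zero_pair_of_sq_eq_neg_weierstrass_coeff`**;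
§97 `evalHom_ne_zero_plus_row_of_not_pow_three_dvd`, `isSquare_neg_weierstrass_coeff_plus_row_of_zero`.

HONEST FRAMING (cell `bsd-potss`; FULL-BSD rank ≤ 1 programme, HUMAN RULING D-0036/D-0074): TOOL THEOREMS ONLY — no definition, no named
fact, no `sorry`, axioms standard; nothing about (A), (C1⁺_η), C-cc-1 or `BSD(W,p)` of any pair is claimed; no stub of 19606 is proved;
crux and route OPEN; nothing booked. `--supports stmt-BirchSwinnertonDyer-19606`.

References: [Washington1997] §7.1, §13.2; [MazurTateTeitelbaum1986Invent] §I.17; [GreenbergLNM1716] §1, §5; [Pollack2003] Thm. 5.13.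
Tree: Parts XXVI, XXVIII–XXX; Mathlib `Polynomial.mul_divByMonic_eq_iff_isRoot`, `Polynomial.IsDistinguishedAt.map_eq_X_pow`.
-/

set_option autoImplicit false
set_option linter.dupNamespace false
noncomputable section

open scoped Classical MatrixGroups ModularForm Topology

open PowerSeries CongruenceSubgroup WeierstrassCurve Literature.NumberTheory.EllipticCurves Literature.NumberTheory.EllipticCurves.ModularForms
open Literature.NumberTheory.EllipticCurves.IwasawaAlgebra
open Summit.BirchSwinnertonDyer.Rank1Residual.Additive
open Summit.BirchSwinnertonDyer.Rank1Residual.X1.MuLambda (mu lam)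

namespace Summit.BirchSwinnertonDyer.BirchSwinnertonDyer.Theorems.EtaThetaFunctionalEquation

variable {p : ℕ} [hp : Fact p.Prime] {r : ℤ_[p]} {S Z : IwasawaAlgebra p}

/-! ## §94 Dividing a distinguished polynomial by a root keeps it distinguished -/

/-- A root of a distinguished polynomial of positive degree lies in `𝔪`: `z₀^d = −Σ_{i<d} h_i z₀^i ∈ 𝔪`. [cite: Washington1997, §7.1] -/
theorem mem_maximalIdeal_of_root_of_isDistinguishedAt {H : Polynomial ℤ_[p]} (hH : H.IsDistinguishedAt (IsLocalRing.maximalIdeal ℤ_[p]))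
    (hd : 0 < H.natDegree) {z₀ : ℤ_[p]} (hz : H.eval z₀ = 0) : z₀ ∈ IsLocalRing.maximalIdeal ℤ_[p] := by
  have hmapX : H.map (IsLocalRing.residue ℤ_[p]) = Polynomial.X ^ H.natDegree := hH.map_eq_X_pow
  have hmap : (H.map (IsLocalRing.residue ℤ_[p])).eval (IsLocalRing.residue ℤ_[p] z₀) = 0 := by
    rw [Polynomial.eval_map, Polynomial.eval₂_at_apply, hz, map_zero]
  rw [hmapX, Polynomial.eval_pow, Polynomial.eval_X] at hmap
  exact (IsLocalRing.residue_eq_zero_iff _).mp ((pow_eq_zero_iff hd.ne').mp hmap)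

/-- **`H = (Z − z₀)·H₁` with `H₁` DISTINGUISHED of degree `deg H − 1`** for a distinguished `H` with root `z₀` (`H₁ = H /ₘ (Z − z₀)`; monic; mod `𝔪`:
`Z·H̄₁ = Z^d` in `k[Z]`, cancel). [cite: Washington1997, §7.1] -/
theorem divByMonic_isDistinguishedAt_of_root {H : Polynomial ℤ_[p]} (hH : H.IsDistinguishedAt (IsLocalRing.maximalIdeal ℤ_[p]))
    (hd : 0 < H.natDegree) {z₀ : ℤ_[p]} (hz : H.eval z₀ = 0) :
    H = (Polynomial.X - Polynomial.C z₀) * (H /ₘ (Polynomial.X - Polynomial.C z₀)) ∧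
      (H /ₘ (Polynomial.X - Polynomial.C z₀)).natDegree = H.natDegree - 1 ∧
      (H /ₘ (Polynomial.X - Polynomial.C z₀)).IsDistinguishedAt (IsLocalRing.maximalIdeal ℤ_[p]) := by
  set H₁ := H /ₘ (Polynomial.X - Polynomial.C z₀) with hH₁
  have hfac : (Polynomial.X - Polynomial.C z₀) * H₁ = H := Polynomial.mul_divByMonic_eq_iff_isRoot.mpr hz
  have hmon : H₁.Monic := (Polynomial.monic_X_sub_C z₀).of_mul_monic_left (by rw [hfac]; exact hH.monic)
  have hdeg : H₁.natDegree = H.natDegree - 1 := by rw [hH₁, Polynomial.natDegree_divByMonic _ (Polynomial.monic_X_sub_C z₀), Polynomial.natDegree_X_sub_C]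
  have hz₀ : IsLocalRing.residue ℤ_[p] z₀ = 0 := (IsLocalRing.residue_eq_zero_iff _).mpr (mem_maximalIdeal_of_root_of_isDistinguishedAt hH hd hz)
  -- mod 𝔪: `X * H̄₁ = X^d`
  have hmap : (Polynomial.X : Polynomial (IsLocalRing.ResidueField ℤ_[p])) * H₁.map (IsLocalRing.residue ℤ_[p]) =
      Polynomial.X * Polynomial.X ^ (H.natDegree - 1) := by
    have hmapX : H.map (IsLocalRing.residue ℤ_[p]) = Polynomial.X ^ H.natDegree := hH.map_eq_X_pow
    have h := congr_arg (Polynomial.map (IsLocalRing.residue ℤ_[p])) hfac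
    rw [Polynomial.map_mul, Polynomial.map_sub, Polynomial.map_X, Polynomial.map_C, hz₀, map_zero, sub_zero, hmapX] at h
    rw [h, ← pow_succ', Nat.sub_add_cancel hd]
  have hmap' : H₁.map (IsLocalRing.residue ℤ_[p]) = Polynomial.X ^ (H.natDegree - 1) := mul_left_cancel₀ Polynomial.X_ne_zero hmap
  refine ⟨hfac.symm, hdeg, ⟨⟨fun {n} hn ↦ ?_⟩, hmon⟩⟩
  rw [hdeg] at hn
  have hc := congr_arg (fun Q ↦ Q.coeff n) hmap'
  simp only [Polynomial.coeff_map, Polynomial.coeff_X_pow, if_neg hn.ne] at hc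
  exact (IsLocalRing.residue_eq_zero_iff _).mp hc

/-! ## §95 `k ≥ 2` and a root in `p²ℤ_p` force `p³ ∣ h₀` -/

/-- The constant coefficient of a distinguished polynomial of positive degree is divisible by `p` (`𝔪 = pℤ_p`). [cite: Washington1997, §7.1] -/
theorem natCast_dvd_coeff_zero_of_isDistinguishedAt {H : Polynomial ℤ_[p]} (hH : H.IsDistinguishedAt (IsLocalRing.maximalIdeal ℤ_[p]))
    (hd : 0 < H.natDegree) : (p : ℤ_[p]) ∣ H.coeff 0 := by
  rw [← Ideal.mem_span_singleton, ← PadicInt.maximalIdeal_eq_span_p]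
  exact hH.mem hd

/-- **`p³ ∣ H(0)`** for a distinguished `H` of degree `≥ 2` with a root `z₀ ∈ p²ℤ_p`: `H = (Z − z₀)H₁`, `H(0) = −z₀·H₁(0)`, `p ∣ H₁(0)`.
[cite: Washington1997, §7.1] -/
theorem natCast_pow_three_dvd_coeff_zero_of_root {H : Polynomial ℤ_[p]} (hH : H.IsDistinguishedAt (IsLocalRing.maximalIdeal ℤ_[p]))
    (hd : 2 ≤ H.natDegree) {z₀ : ℤ_[p]} (hz : H.eval z₀ = 0) (hz2 : (p : ℤ_[p]) ^ 2 ∣ z₀) : (p : ℤ_[p]) ^ 3 ∣ H.coeff 0 := by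
  obtain ⟨hfac, hdeg, hH₁⟩ := divByMonic_isDistinguishedAt_of_root hH (by omega) hz
  have h1 : (p : ℤ_[p]) ∣ (H /ₘ (Polynomial.X - Polynomial.C z₀)).coeff 0 := natCast_dvd_coeff_zero_of_isDistinguishedAt hH₁ (by omega)
  rw [hfac, Polynomial.mul_coeff_zero, Polynomial.coeff_sub, Polynomial.coeff_X_zero, Polynomial.coeff_C_zero, zero_sub, neg_mul, dvd_neg,
    pow_succ]
  exact mul_dvd_mul hz2 h1

/-! ## §96 The second digit of the one-digit test -/

/-- **`k ≥ 2`: A RATIONAL ZERO FORCES `p³ ∣ coeff_{ord_T M}(P)`** — `p` odd, `M ≠ 0`, `ι M = w(1+T)^e M`, ANY Weierstrass datum `M = p^m·P·U` with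
`deg P ≥ ord_T M + 4` (at least two partner pairs), `M(t) = 0` for some `t ∈ ℤ_p`, `0 < ‖t‖ < 1`. [cite: Washington1997, §7.1, §13.2]
[cite: MazurTateTeitelbaum1986Invent, §I.17] -/
theorem natCast_pow_three_dvd_weierstrass_coeff_order_of_zero (hp2 : p ≠ 2) {M : IwasawaAlgebra p} (hM0 : M ≠ 0) {w e : ℤ_[p]}
    (hFE : invol p M = C w * binomialSeries ℤ_[p] e * M) {m : ℕ} {P : Polynomial ℤ_[p]}
    (hP : P.IsDistinguishedAt (IsLocalRing.maximalIdeal ℤ_[p])) {U : IwasawaAlgebra p} (hU : IsUnit U)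
    (hMP : M = C ((p : ℤ_[p]) ^ m) * (P : IwasawaAlgebra p) * U) (hdeg : (PowerSeries.order M).toNat + 4 ≤ P.natDegree)
    {t : ℤ_[p]} (ht : ‖t‖ < 1) (ht0 : t ≠ 0) (hzero : evalHom t ht M = 0) :
    (p : ℤ_[p]) ^ 3 ∣ P.coeff (PowerSeries.order M).toNat := by
  obtain ⟨r, hr⟩ := exists_two_mul_eq_neg_one (p := p) hp2
  obtain ⟨-, H, -, -, hH, -, -, hPeq, -, hPdeg⟩ :=
    weierstrass_eq_X_pow_mul_normPoly_of_invol_eq hr (S := X * binomialSeries ℤ_[p] r) rfl (Z := X + invol p X) rfl hM0 hFE hP hU hMP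
  obtain ⟨t', htt⟩ := exists_partner_of_norm_lt_one ht
  have hpm : ((p : ℤ_[p]) ^ m) ≠ 0 := pow_ne_zero _ (Nat.cast_ne_zero.mpr hp.out.ne_zero)
  have hroot : H.eval (t + t') = 0 := by
    rcases (evalHom_eq_zero_iff_of_eq_X_pow_mul_normPoly hPeq hpm hU hMP ht htt).mp hzero with ⟨h0, -⟩ | h
    · exact absurd h0 ht0
    · exact h
  rw [hPeq, coeff_X_pow_mul_normPoly]
  exact natCast_pow_three_dvd_coeff_zero_of_root hH (by omega) hroot (natCast_sq_dvd_add_partner hp2 ht htt)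

/-- **`k ≥ 2`, datum-free: a rational zero forces `p³ ∣ coeff_{ord_T M}(M)`** when `λ(M) ≥ ord_T M + 4`. [cite: Washington1997, §7.1, §13.2] -/
theorem natCast_pow_three_dvd_coeff_order_of_zero (hp2 : p ≠ 2) {M : IwasawaAlgebra p} (hM0 : M ≠ 0) {w e : ℤ_[p]}
    (hFE : invol p M = C w * binomialSeries ℤ_[p] e * M) (hlam : (PowerSeries.order M).toNat + 4 ≤ lam M)
    {t : ℤ_[p]} (ht : ‖t‖ < 1) (ht0 : t ≠ 0) (hzero : evalHom t ht M = 0) :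
    (p : ℤ_[p]) ^ 3 ∣ coeff (PowerSeries.order M).toNat M := by
  obtain ⟨r, hr⟩ := exists_two_mul_eq_neg_one (p := p) hp2
  obtain ⟨P, U, hP, hU, hPlam, hMP⟩ := exists_weierstrass_of_ne_zero hM0
  obtain ⟨-, H, -, -, -, -, -, hPeq, hPZ, -⟩ :=
    weierstrass_eq_X_pow_mul_normPoly_of_invol_eq hr (S := X * binomialSeries ℤ_[p] r) rfl (Z := X + invol p X) rfl hM0 hFE hP hU hMP
  have h3 := natCast_pow_three_dvd_weierstrass_coeff_order_of_zero hp2 hM0 hFE hP hU hMP (by rw [hPlam]; exact hlam) ht ht0 hzero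
  rw [hPeq, coeff_X_pow_mul_normPoly] at h3
  rw [coeff_order_eq_of_normForm rfl hMP hPZ]
  exact Dvd.dvd.mul_right (Dvd.dvd.mul_left h3 _) _

/-- **`k ≥ 2`: `p³ ∤ coeff_{ord_T M}(P)` ⟹ NO zero of `M` in `pℤ_p ∖ {0}`** (any Weierstrass datum with `deg P ≥ ord_T M + 4`).
[cite: Washington1997, §7.1, §13.2] [cite: MazurTateTeitelbaum1986Invent, §I.17] -/
theorem evalHom_ne_zero_of_not_pow_three_dvd (hp2 : p ≠ 2) {M : IwasawaAlgebra p} (hM0 : M ≠ 0) {w e : ℤ_[p]}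
    (hFE : invol p M = C w * binomialSeries ℤ_[p] e * M) {m : ℕ} {P : Polynomial ℤ_[p]}
    (hP : P.IsDistinguishedAt (IsLocalRing.maximalIdeal ℤ_[p])) {U : IwasawaAlgebra p} (hU : IsUnit U)
    (hMP : M = C ((p : ℤ_[p]) ^ m) * (P : IwasawaAlgebra p) * U) (hdeg : (PowerSeries.order M).toNat + 4 ≤ P.natDegree)
    (hnd : ¬ (p : ℤ_[p]) ^ 3 ∣ P.coeff (PowerSeries.order M).toNat) {t : ℤ_[p]} (ht : ‖t‖ < 1) (ht0 : t ≠ 0) : evalHom t ht M ≠ 0 :=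
  fun hzero ↦ hnd (natCast_pow_three_dvd_weierstrass_coeff_order_of_zero hp2 hM0 hFE hP hU hMP hdeg ht ht0 hzero)

/-- **`k = 1`: A RATIONAL ZERO FORCES `−coeff_{ord_T M}(P) ∈ (ℤ_p)²`** (any datum with `deg P = ord_T M + 2`): `H = Z + h₀`, the norm `z₀ = −h₀` of the
zero pair is `S(t)²`. [cite: MazurTateTeitelbaum1986Invent, §I.17] [cite: Washington1997, §13.2] -/
theorem isSquare_neg_weierstrass_coeff_order_of_zero (hp2 : p ≠ 2) {M : IwasawaAlgebra p} (hM0 : M ≠ 0) {w e : ℤ_[p]}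
    (hFE : invol p M = C w * binomialSeries ℤ_[p] e * M) {m : ℕ} {P : Polynomial ℤ_[p]}
    (hP : P.IsDistinguishedAt (IsLocalRing.maximalIdeal ℤ_[p])) {U : IwasawaAlgebra p} (hU : IsUnit U)
    (hMP : M = C ((p : ℤ_[p]) ^ m) * (P : IwasawaAlgebra p) * U) (hdeg : P.natDegree = (PowerSeries.order M).toNat + 2)
    {t : ℤ_[p]} (ht : ‖t‖ < 1) (ht0 : t ≠ 0) (hzero : evalHom t ht M = 0) :
    IsSquare (-P.coeff (PowerSeries.order M).toNat) := by
  obtain ⟨r, hr⟩ := exists_two_mul_eq_neg_one (p := p) hp2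
  obtain ⟨-, H, -, -, hH, -, -, hPeq, -, hPdeg⟩ :=
    weierstrass_eq_X_pow_mul_normPoly_of_invol_eq hr (S := X * binomialSeries ℤ_[p] r) rfl (Z := X + invol p X) rfl hM0 hFE hP hU hMP
  obtain ⟨t', htt⟩ := exists_partner_of_norm_lt_one ht
  have hpm : ((p : ℤ_[p]) ^ m) ≠ 0 := pow_ne_zero _ (Nat.cast_ne_zero.mpr hp.out.ne_zero)
  have hroot : H.eval (t + t') = 0 := by
    rcases (evalHom_eq_zero_iff_of_eq_X_pow_mul_normPoly hPeq hpm hU hMP ht htt).mp hzero with ⟨h0, -⟩ | h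
    · exact absurd h0 ht0
    · exact h
  have hk : H.natDegree = 1 := by omega
  -- `H = Z + h₀` (monic of degree 1): `H(z₀) = z₀ + h₀`
  have hHe : H.eval (t + t') = (t + t') + H.coeff 0 := by
    rw [Polynomial.eval_eq_sum_range, hk, Finset.sum_range_succ, Finset.sum_range_one, pow_zero, mul_one, pow_one,
      show H.coeff 1 = 1 by rw [← hk]; exact hH.monic.coeff_natDegree, one_mul, add_comm]
  rw [hPeq, coeff_X_pow_mul_normPoly, show -H.coeff 0 = t + t' by linear_combination -(hHe.symm.trans hroot)]
  exact isSquare_add_partner hp2 ht htt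

/-- **`k = 1`, CONVERSELY: a square root `s₀ ∈ pℤ_p ∖ 0` of `−coeff_{ord_T M}(P)` GIVES the rational zero pair** (any datum with `deg P = ord_T M + 2`):
`H = Z + h₀`, `H(s₀²) = 0`, Part XXIX. [cite: MazurTateTeitelbaum1986Invent, §I.17] [cite: Washington1997, §13.2] -/
theorem exists_zero_pair_of_sq_eq_neg_weierstrass_coeff (hp2 : p ≠ 2) {M : IwasawaAlgebra p} (hM0 : M ≠ 0) {w e : ℤ_[p]}
    (hFE : invol p M = C w * binomialSeries ℤ_[p] e * M) {m : ℕ} {P : Polynomial ℤ_[p]}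
    (hP : P.IsDistinguishedAt (IsLocalRing.maximalIdeal ℤ_[p])) {U : IwasawaAlgebra p} (hU : IsUnit U)
    (hMP : M = C ((p : ℤ_[p]) ^ m) * (P : IwasawaAlgebra p) * U) (hdeg : P.natDegree = (PowerSeries.order M).toNat + 2)
    {s₀ : ℤ_[p]} (hs₀ : ‖s₀‖ < 1) (hs0 : s₀ ≠ 0) (hsq : s₀ ^ 2 = -P.coeff (PowerSeries.order M).toNat) :
    ∃ (t t' : ℤ_[p]) (ht : ‖t‖ < 1) (ht' : ‖t'‖ < 1), t ≠ 0 ∧ (1 + t) * (1 + t') = 1 ∧ t + t' = s₀ ^ 2 ∧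
      evalHom t ht M = 0 ∧ evalHom t' ht' M = 0 := by
  obtain ⟨r, hr⟩ := exists_two_mul_eq_neg_one (p := p) hp2
  obtain ⟨-, H', -, -, hH', -, -, hPeq', -, hPdeg'⟩ :=
    weierstrass_eq_X_pow_mul_normPoly_of_invol_eq hr (S := X * binomialSeries ℤ_[p] r) rfl (Z := X + invol p X) rfl hM0 hFE hP hU hMP
  have hk' : H'.natDegree = 1 := by omega
  -- `H'(s₀²) = s₀² + h₀' = 0` with `h₀' = coeff_{r₀} P = -s₀²`
  have hcoeff : P.coeff (PowerSeries.order M).toNat = H'.coeff 0 := by rw [hPeq', coeff_X_pow_mul_normPoly]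
  have hroot' : H'.eval (s₀ ^ 2) = 0 := by
    rw [Polynomial.eval_eq_sum_range, hk', Finset.sum_range_succ, Finset.sum_range_one, pow_zero, mul_one, pow_one,
      show H'.coeff 1 = 1 by rw [← hk']; exact hH'.monic.coeff_natDegree, one_mul, ← hcoeff, hsq, add_neg_cancel]
  have ht := norm_evalHom_substInv_lt_one (S := X * binomialSeries ℤ_[p] r) rfl hs₀
  obtain ⟨t', htt⟩ := exists_partner_of_norm_lt_one ht
  have hpm : ((p : ℤ_[p]) ^ m) ≠ 0 := pow_ne_zero _ (Nat.cast_ne_zero.mpr hp.out.ne_zero)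
  have hzero := evalHom_eq_zero_of_sq_root hr (S := X * binomialSeries ℤ_[p] r) rfl hPeq' hpm hU hMP hs₀ hroot'
  have hzero' : evalHom t' (norm_lt_one_of_partner htt ht) M = 0 := by
    rw [← evalHom_invol ht (norm_lt_one_of_partner htt ht) htt M, hFE, map_mul, map_mul, hzero, mul_zero]
  exact ⟨_, t', ht, norm_lt_one_of_partner htt ht, fun h0 ↦ hs0 (eq_zero_of_evalHom_substInv_eq_zero rfl hs₀ h0), htt,
    add_partner_eq_sq hr rfl hs₀ htt, hzero, hzero'⟩

/-! ## §97 On the quadratic branch (rows) -/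

section Branch

variable {N : ℕ} [NeZero N] {f : CuspForm (Gamma0 N) 2}

/-- **AT A ROW (plus), `k ≥ 2`: `p³ ∤ coeff_{ord}(P)` ⟹ NO `ℤ_p`-rational zero of `L_p⁺(V, η, X)` in the punctured disc** (`V` globally minimal, good
at `p ≥ 5`, `a_p(V) = 0`, `f` its newform, any period ratio, any nonzero `Lη`, any datum `Lη = p^m·P·U` with `deg P ≥ ord Lη + 4`).
[cite: MazurTateTeitelbaum1986Invent, §I.17] [cite: Pollack2003, Thm. 5.13] -/
theorem evalHom_ne_zero_plus_row_of_not_pow_three_dvd (hp5 : 5 ≤ p) (V : WeierstrassCurve ℚ) [V.IsElliptic] [V.IsGloballyMinimal]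
    (hgood : V.HasGoodReductionAtPrime p) (hap : V.frobeniusTrace p = 0) (hf : IsNewformOf V f) (ϖ : ℚ) {Lη : IwasawaAlgebra p}
    (hL : IsQuadraticBranchPlusLFunction f p ϖ Lη) (hL0 : Lη ≠ 0) {m : ℕ} {P : Polynomial ℤ_[p]}
    (hP : P.IsDistinguishedAt (IsLocalRing.maximalIdeal ℤ_[p])) {U : IwasawaAlgebra p} (hU : IsUnit U)
    (hLP : Lη = C ((p : ℤ_[p]) ^ m) * (P : IwasawaAlgebra p) * U) (hdeg : (PowerSeries.order Lη).toNat + 4 ≤ P.natDegree)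
    (hnd : ¬ (p : ℤ_[p]) ^ 3 ∣ P.coeff (PowerSeries.order Lη).toNat) {t : ℤ_[p]} (ht : ‖t‖ < 1) (ht0 : t ≠ 0) :
    evalHom t ht Lη ≠ 0 := by
  have hp2 : p ≠ 2 := by omega
  have hap' : cuspCoeff f p = ((0 : ℤ) : ℂ) := by
    rw [cuspCoeff_eq_frobeniusTrace_of_isNewformOf_holds hf hgood, hap]
  obtain ⟨σ, hσ, hW⟩ := exists_frickeSign_of_isNewform0 hf.1
  obtain ⟨e, he⟩ := exists_invol_eq_of_isQuadraticBranchPlusLFunction hp2 hf.1 hf.coeffField_eq_bot (not_dvd_level_of_isNewformOf hf hgood)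
    hap' hσ hW hL
  exact evalHom_ne_zero_of_not_pow_three_dvd hp2 hL0 he hP hU hLP hdeg hnd ht ht0

/-- **AT A ROW (plus), `k = 1`: a rational zero forces `−coeff_{ord}(P) ∈ (ℤ_p)²`; a nonzero square root of `−coeff_{ord}(P)` in `pℤ_p` gives one**
(any datum with `deg P = ord Lη + 2`). [cite: MazurTateTeitelbaum1986Invent, §I.17] [cite: Pollack2003, Thm. 5.13] -/
theorem isSquare_neg_weierstrass_coeff_plus_row_iff (hp5 : 5 ≤ p) (V : WeierstrassCurve ℚ) [V.IsElliptic] [V.IsGloballyMinimal]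
    (hgood : V.HasGoodReductionAtPrime p) (hap : V.frobeniusTrace p = 0) (hf : IsNewformOf V f) (ϖ : ℚ) {Lη : IwasawaAlgebra p}
    (hL : IsQuadraticBranchPlusLFunction f p ϖ Lη) (hL0 : Lη ≠ 0) {m : ℕ} {P : Polynomial ℤ_[p]}
    (hP : P.IsDistinguishedAt (IsLocalRing.maximalIdeal ℤ_[p])) {U : IwasawaAlgebra p} (hU : IsUnit U)
    (hLP : Lη = C ((p : ℤ_[p]) ^ m) * (P : IwasawaAlgebra p) * U) (hdeg : P.natDegree = (PowerSeries.order Lη).toNat + 2) :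
    ((∃ (t : ℤ_[p]) (ht : ‖t‖ < 1), t ≠ 0 ∧ evalHom t ht Lη = 0) ↔
      ∃ s₀ : ℤ_[p], ‖s₀‖ < 1 ∧ s₀ ≠ 0 ∧ s₀ ^ 2 = -P.coeff (PowerSeries.order Lη).toNat) := by
  have hp2 : p ≠ 2 := by omega
  have hap' : cuspCoeff f p = ((0 : ℤ) : ℂ) := by
    rw [cuspCoeff_eq_frobeniusTrace_of_isNewformOf_holds hf hgood, hap]
  obtain ⟨σ, hσ, hW⟩ := exists_frickeSign_of_isNewform0 hf.1
  obtain ⟨e, he⟩ := exists_invol_eq_of_isQuadraticBranchPlusLFunction hp2 hf.1 hf.coeffField_eq_bot (not_dvd_level_of_isNewformOf hf hgood)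
    hap' hσ hW hL
  constructor
  · rintro ⟨t, ht, ht0, hzero⟩
    obtain ⟨s, hs⟩ := isSquare_neg_weierstrass_coeff_order_of_zero hp2 hL0 he hP hU hLP hdeg ht ht0 hzero
    obtain ⟨r, hr⟩ := exists_two_mul_eq_neg_one (p := p) hp2
    obtain ⟨t', htt⟩ := exists_partner_of_norm_lt_one ht
    -- the norm is nonzero (only `0` is self-annihilating: `t + t' = 0` with `(1+t)(1+t') = 1` forces `t² = 0`)
    have hne : -P.coeff (PowerSeries.order Lη).toNat ≠ 0 := by
      intro h0
      -- `h₀ = 0` would make the norm `t + t' = 0`, and only `t = 0` is self-annihilating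
      obtain ⟨-, H, -, -, hH, -, -, hPeq, -, hPdeg⟩ :=
        weierstrass_eq_X_pow_mul_normPoly_of_invol_eq hr (S := X * binomialSeries ℤ_[p] r) rfl (Z := X + invol p X) rfl hL0 he hP hU hLP
      have hpm : ((p : ℤ_[p]) ^ m) ≠ 0 := pow_ne_zero _ (Nat.cast_ne_zero.mpr hp.out.ne_zero)
      have hroot : H.eval (t + t') = 0 := by
        rcases (evalHom_eq_zero_iff_of_eq_X_pow_mul_normPoly hPeq hpm hU hLP ht htt).mp hzero with ⟨h00, -⟩ | h
        · exact absurd h00 ht0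
        · exact h
      have hk : H.natDegree = 1 := by omega
      have hHe : H.eval (t + t') = (t + t') + H.coeff 0 := by
        rw [Polynomial.eval_eq_sum_range, hk, Finset.sum_range_succ, Finset.sum_range_one, pow_zero, mul_one, pow_one,
          show H.coeff 1 = 1 by rw [← hk]; exact hH.monic.coeff_natDegree, one_mul, add_comm]
      have hc0 : H.coeff 0 = 0 := by
        have : P.coeff (PowerSeries.order Lη).toNat = H.coeff 0 := by rw [hPeq, coeff_X_pow_mul_normPoly]
        rw [← this]; exact neg_eq_zero.mp h0
      have hsum : t + t' = 0 := by rw [hHe, hc0, add_zero] at hroot; exact hroot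
      have ht2 : t ^ 2 = 0 := by rw [← one_add_mul_add_partner htt, hsum, mul_zero]
      exact ht0 (pow_eq_zero_iff two_ne_zero |>.mp ht2)
    have hs0 : s ≠ 0 := fun h ↦ hne (by rw [hs, h, mul_zero])
    have hsn : ‖s‖ < 1 := by
      by_contra hge
      have h1 : ‖s‖ = 1 := le_antisymm (PadicInt.norm_le_one s) (not_lt.mp hge)
      have hdist : (p : ℤ_[p]) ∣ P.coeff (PowerSeries.order Lη).toNat := by
        rw [← Ideal.mem_span_singleton, ← PadicInt.maximalIdeal_eq_span_p]; exact hP.mem (by omega)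
      have hn : ‖P.coeff (PowerSeries.order Lη).toNat‖ < 1 := (PadicInt.norm_lt_one_iff_dvd _).mpr hdist
      rw [← norm_neg, hs, norm_mul, h1, one_mul] at hn
      exact lt_irrefl _ hn
    exact ⟨s, hsn, hs0, by rw [sq]; exact hs.symm⟩
  · rintro ⟨s₀, hs₀, hs0, hsq⟩
    obtain ⟨t, t', ht, -, ht0, -, -, hzero, -⟩ := exists_zero_pair_of_sq_eq_neg_weierstrass_coeff hp2 hL0 he hP hU hLP hdeg hs₀ hs0 hsq
    exact ⟨t, ht, ht0, hzero⟩

end Branch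

end Summit.BirchSwinnertonDyer.BirchSwinnertonDyer.Theorems.EtaThetaFunctionalEquation

end
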